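import Literature.AnabelianGeometry.SemiGraphs.FiniteEtaleCoveringDictionary
import Literature.AnabelianGeometry.SemiGraphs.CoveringGlobalProofs
import Literature.AnabelianGeometry.SemiGraphs.CoveringHomCanBranchAligned
import Literature.AnabelianGeometry.SemiGraphs.CoveringOfObjectVertexAligned

/-!
# [SemiAnbd] Def. 2.2 (i): the covering attached to an object EXISTS with all four clauses — proof

Mochizuki, *Semi-graphs of anabelioids*, Publ. RIMS **42** (2006) 221–322, §2 p. 23 and Prop. 2.6
proof ¶1 p. 30 [cite: MochizukiSemiAnbd2006, Def. 2.2(i) p.23].  abc-iut cell, layer L3, row W4-14b: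
this PROOF-ONLY file (no `def`) discharges the four-clause NAMED FACT
`exists_finiteEtaleCoveringGlobal` of `FiniteEtaleCoveringDictionary.lean` (abc-iut-L3-d3, dictionary
v4) — for every connected semi-graph of anabelioids `𝒢` with a vertex and every object `A` of `B(𝒢)`
there is a covering `φ : 𝒢′ → 𝒢` which is the finite étale covering attached to `A` LOCALLY
(`IsFiniteEtaleCoveringOf`), GLOBALLY (`IsGlobalCoveringOf`), with ALIGNED branch functors
(`IsBranchAligned`) and ALIGNED vertex groups (`IsVertexAligned`) — by ASSEMBLING the four kernel
theorems about print's constructed covering `𝒢_A → 𝒢` (`𝒢′ := A.coveringGraph`,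
`φ := A.coveringHomCan = A.coveringHom`):

* local clause — abc-iut-L3-t5, `BObj.coveringHomCan_isFiniteEtaleCoveringOf` (`CoveringOfObjectProofs.lean`);
* global clause — abc-iut-L3-t5, `BObj.coveringHomCan_isGlobalCoveringOf` (`CoveringGlobalProofs.lean`,
  the equivalence `B(𝒢)_{/A} ≃ B(𝒢_A)`);
* branch alignment — abc-iut-L4-t17, `BObj.coveringHomCan_isBranchAligned`
  (`CoveringHomCanBranchAligned.lean`);
* vertex alignment — abc-iut-w4-d071, `BObj.coveringHomCan_isVertexAligned`
  (`CoveringOfObjectVertexAligned.lean`).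

It is the named fact CONSUMED by the Cor. 2.7 (i) reduction `corollary_2_7_i_of_dictionary`
(`CommensurableTerminalityProofs.lean`, abc-iut-L3-d3), whose hypothesis `exists_finiteEtaleCoveringGlobal`
is hereby a theorem.  Also recorded: the constructed covering is a finite étale covering in print's
full sense, `Hom.IsFiniteEtaleCoveringGlobal` (`Coverticial.lean`), in both presentations.  The
hypotheses "connected, with a vertex" of the named fact are not used by the construction.
Nothing here bears on [IUTchIII] Cor. 3.12; this row is discharged (sorry-free, axioms standard).
-/

namespace Literature.AnabelianGeometry.SemiGraphs

namespace SemiGraphOfAnabelioids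

universe v₁ u₁ u

variable {𝒢 : SemiGraphOfAnabelioids.{v₁, u₁, u}}

/-- **`coveringHomCan A : 𝒢_A → 𝒢` is a finite étale covering of `𝒢` in print's full sense**
(local ∧ global ∧ branch-aligned ∧ vertex-aligned, witnessed by the object `A` itself).
[cite: MochizukiSemiAnbd2006, Def. 2.2(i) p.23] -/
theorem BObj.coveringHomCan_isFiniteEtaleCoveringGlobal (A : 𝒢.BObj) :
    A.coveringHomCan.IsFiniteEtaleCoveringGlobal :=
  ⟨A, A.coveringHomCan_isFiniteEtaleCoveringOf, A.coveringHomCan_isGlobalCoveringOf,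
    A.coveringHomCan_isBranchAligned, A.coveringHomCan_isVertexAligned⟩

/-- **`coveringHom A : 𝒢_A → 𝒢` is a finite étale covering of `𝒢` in print's full sense** — the same
for abc-iut-L3-t5's presentation with Mathlib-composite 2-cells, along `coveringHomCan_eq_coveringHom`.
[cite: MochizukiSemiAnbd2006, Def. 2.2(i) p.23] -/
theorem BObj.coveringHom_isFiniteEtaleCoveringGlobal (A : 𝒢.BObj) :
    A.coveringHom.IsFiniteEtaleCoveringGlobal := by
  rw [← BObj.coveringHomCan_eq_coveringHom]
  exact A.coveringHomCan_isFiniteEtaleCoveringGlobal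

/-- **[SemiAnbd] Def. 2.2 (i) / Prop. 2.6 proof ¶1: existence of the finite étale covering attached to
an object of `B(𝒢)`, with ALL FOUR clauses** — the named fact `exists_finiteEtaleCoveringGlobal`
holds: take `𝒢′ := 𝒢_A`, `φ := coveringHomCan A`. [cite: MochizukiSemiAnbd2006, Prop. 2.6 proof p.30] -/
theorem exists_finiteEtaleCoveringGlobal_holds : exists_finiteEtaleCoveringGlobal.{v₁, u₁, u} :=
  fun _ _ _ A => ⟨A.coveringGraph, A.coveringHomCan, A.coveringHomCan_isFiniteEtaleCoveringOf,
    A.coveringHomCan_isGlobalCoveringOf, A.coveringHomCan_isBranchAligned,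
    A.coveringHomCan_isVertexAligned⟩

end SemiGraphOfAnabelioids

end Literature.AnabelianGeometry.SemiGraphs
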